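import Literature.NumberTheory.Weil1982.CayleyProductSandwich      -- ★ (C2) p851775: `cayley_mul_cayley_eq_cayley`, `valBound_cayleySandwich{,_incr,_sub_add}`, `isUnit_det_one_{sub,add,add_mul}_of_valBound`
import HarnessLib

/-!
# The twisted Cayley sandwich: the tube map `(X, Y) ↦ t₀⁻¹·c(X)·t₀·c(Y)·c(X)⁻¹` in the chart is `Ad(t₀⁻¹)X − X + Y` up to one level

Topic `NumberTheory/Weil1982`; namespace `Literature.NumberTheory.Weil1982.UnitaryFinTopForm` (continues ★ (J2α) `UnitaryFinCayleyWindow` §3 and ★ (C2)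
`CayleyProductSandwich`).  THEOREMS ONLY (no definition ∕ instance ∕ notation ∕ named fact ∕ `sorry`); Mathlib + ★ (C2).  Cell `pub/hodgecm-mathlib`, crux H413
= `stmt-HodgeConjecture-24833`, ROAD «JAC-ELL» v0 (`F0/P3c/LH5/LH5-p02/g6/ROAD-JAC-ELL.v0.LH5p02g6.md`) brick C5.  Count-neutral.

THE MATHEMATICS ([Serre1992LALG] Part II Ch. IV §8: in a standard group the commutator∕conjugation maps are given by power series whose linear parts are the
obvious ones; here in the exact Cayley form of [PlatonovRapinchuk1994] §3.3).  `S(W, X) := (1 − W)⁻¹(W + X)(1 + WX)⁻¹(1 − W)` is the chart of the product: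
`c(W)c(X) = c(S(W, X))` (★ (C2)).  This file adds:
* §1 the FIRST-ARGUMENT increment of `S`: `S(W + D, X) − S(W, X) − D` has entries `≤ ρδ` for `W, X ≤ ρ < 1`, `D ≤ δ ≤ ρ` (`valBound_cayleySandwich_incr_left`;
  exact four-term telescoping `cayleySandwich_incr_left_eq` + the resolvent identities) — the companion of ★ (C2)'s second-argument `valBound_cayleySandwich_incr`;
* §2 conjugation: `T⁻¹ c(X) T = c(T⁻¹ X T)` (`conj_cayley`);
* §3 the TUBE IN THE CHART: `T⁻¹·c(X)·T·c(Y)·c(−X) = c(Θ)` with `Θ = S(T⁻¹XT, S(Y, −X))` (`cayley_twisted_triple`), `Θ|_{X = Y = 0} = 0`, `Θ` stays in the box;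
* §4 the JOINT increment `S(W + D, X + E) − S(W, X) − D − E ≤ ρ·max δ ε` (`valBound_cayleySandwich_incr_both`) and **the filtered Newton estimate with linear
  part `L(X₁, Y₁) = T⁻¹X₁T − X₁ + Y₁`**: for `T, T⁻¹` integral and `X, Y ≤ ρ < 1`, `X₁, Y₁ ≤ γ ≤ ρ`, `Θ(X + X₁, Y + Y₁) − Θ(X, Y) − (T⁻¹X₁T − X₁ + Y₁)`
  has entries `≤ ργ` — stated for ANY box-stable binary operation with such joint increments (`valBound_twisted_incr_of_sandwich`) and for the
  Cayley sandwich (`valBound_twistedSandwich_incr`) — one level gained as soon as the box is one level deep.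
  This is hypothesis `(N_L)` of ★ (C1) `F0P3cStCharTSFilteredNewton` for the tube map at a regular `t₀ = T` of a compact Cartan, up to the inverse bound of `L`
  (brick C8).
HONEST LABEL: HC_CM is proved only modulo the 7 printed citations (2 remaining named inputs: hLiu418 = `stmt-HodgeConjecture-24832`, h413 =
`stmt-HodgeConjecture-24833`) until rung 0 closes; this file closes no organ.

## References
* [Serre1992LALG] J.-P. Serre, *Lie Algebras and Lie Groups*, LNM 1500 (1992), Part II Ch. IV §8 (standard groups: group law and conjugation are `linear + O(2)`).
* [PlatonovRapinchuk1994] V. Platonov, A. Rapinchuk, *Algebraic Groups and Number Theory* (1994), §3.3 (congruence subgroups via the Cayley map).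
-/

set_option autoImplicit false

open Matrix ValuativeRel Literature.NumberTheory.Automorphic
open scoped Matrix

namespace Literature.NumberTheory.Weil1982.UnitaryFinTopForm

/-! ## §1 The first-argument increment of the sandwich -/

section Ring

variable {R : Type*} [CommRing R] {n : Type*} [Fintype n] [DecidableEq n]

/-- Resolvent identity `P₂⁻¹ − P⁻¹ = P₂⁻¹ (P − P₂) P⁻¹`. [cite: Serre1992LALG, Part II Ch. IV §8] -/
theorem inv_sub_inv_eq {P P₂ : Matrix n n R} (hP : IsUnit P.det) (hP₂ : IsUnit P₂.det) :
    P₂⁻¹ - P⁻¹ = P₂⁻¹ * (P - P₂) * P⁻¹ := by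
  have h1 : P₂⁻¹ * P₂ = 1 := Matrix.nonsing_inv_mul _ hP₂
  have h2 : P * P⁻¹ = 1 := Matrix.mul_nonsing_inv _ hP
  calc P₂⁻¹ - P⁻¹ = P₂⁻¹ * (P * P⁻¹) - (P₂⁻¹ * P₂) * P⁻¹ := by rw [h1, h2, Matrix.mul_one, Matrix.one_mul]
    _ = P₂⁻¹ * (P - P₂) * P⁻¹ := by noncomm_ring

/-- **Four-term telescoping** of the first-argument increment: with `P = 1 − W`, `P₂ = 1 − W₂`, `A = W + X`, `A₂ = W₂ + X`, `B = 1 + WX`, `B₂ = 1 + W₂X`,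
`S₂ − S = (P₂⁻¹ − P⁻¹)A₂B₂⁻¹P₂ + P⁻¹(A₂ − A)B₂⁻¹P₂ + P⁻¹A(B₂⁻¹ − B⁻¹)P₂ + P⁻¹AB⁻¹(P₂ − P)` (any ring). [cite: Serre1992LALG, Part II Ch. IV §8] -/
theorem cayleySandwich_sub_cayleySandwich_eq (W W₂ X : Matrix n n R) :
    (1 - W₂)⁻¹ * (W₂ + X) * (1 + W₂ * X)⁻¹ * (1 - W₂) - (1 - W)⁻¹ * (W + X) * (1 + W * X)⁻¹ * (1 - W)
      = ((1 - W₂)⁻¹ - (1 - W)⁻¹) * (W₂ + X) * (1 + W₂ * X)⁻¹ * (1 - W₂)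
        + (1 - W)⁻¹ * ((W₂ + X) - (W + X)) * (1 + W₂ * X)⁻¹ * (1 - W₂)
        + (1 - W)⁻¹ * (W + X) * ((1 + W₂ * X)⁻¹ - (1 + W * X)⁻¹) * (1 - W₂)
        + (1 - W)⁻¹ * (W + X) * (1 + W * X)⁻¹ * ((1 - W₂) - (1 - W)) := by
  noncomm_ring

end Ring

section Valued

variable {F : Type*} [Field F] [ValuativeRel F] {m : Type*} [Fintype m] [DecidableEq m]

/-- **FIRST-ARGUMENT INCREMENT**: for `W, X ≤ ρ < 1` and `D ≤ δ ≤ ρ` entrywise, the entries of `S(W + D, X) − S(W, X) − D` are `≤ ρδ`.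
[cite: Serre1992LALG, Part II Ch. IV §8] -/
theorem valBound_cayleySandwich_incr_left {ρ δ : ValueGroupWithZero F} {W X D : Matrix m m F} (hW : ValBound ρ W) (hX : ValBound ρ X)
    (hD : ValBound δ D) (hρ : ρ < 1) (hδ : δ ≤ ρ) :
    ValBound (ρ * δ) (((1 - (W + D))⁻¹ * ((W + D) + X) * (1 + (W + D) * X)⁻¹ * (1 - (W + D)))
      - ((1 - W)⁻¹ * (W + X) * (1 + W * X)⁻¹ * (1 - W)) - D) := by
  have hW₂ : ValBound ρ (W + D) := hW.add (hD.mono hδ)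
  obtain ⟨hPu, hPinv, -⟩ := isUnit_det_one_sub_of_valBound hW hρ
  obtain ⟨hP₂u, hP₂inv, -⟩ := isUnit_det_one_sub_of_valBound hW₂ hρ
  obtain ⟨hBu, hBinv, -⟩ := isUnit_det_one_add_mul_of_valBound hW hX hρ hρ.le
  obtain ⟨hB₂u, hB₂inv, hE₂⟩ := isUnit_det_one_add_mul_of_valBound hW₂ hX hρ hρ.le
  have hP1 : ValBound 1 (1 - W) := valBound_one_one_sub hW hρ.le
  have hP₂1 : ValBound 1 (1 - (W + D)) := valBound_one_one_sub hW₂ hρ.le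
  have hA : ValBound ρ (W + X) := hW.add hX
  have hA₂ : ValBound ρ (W + D + X) := hW₂.add hX
  have hρ1 : ρ ≤ 1 := hρ.le
  rw [cayleySandwich_sub_cayleySandwich_eq]
  -- the substitutions
  have e1 : (1 - (W + D))⁻¹ - (1 - W)⁻¹ = (1 - (W + D))⁻¹ * D * (1 - W)⁻¹ := by
    rw [inv_sub_inv_eq hPu hP₂u]; congr 1; congr 1; abel
  have e2 : (W + D + X) - (W + X) = D := by abel
  have e3 : (1 + (W + D) * X)⁻¹ - (1 + W * X)⁻¹ = -((1 + (W + D) * X)⁻¹ * (D * X) * (1 + W * X)⁻¹) := by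
    have := inv_one_add_mul_add_sub_inv (W := 1) (X := W * X) (Y := D * X) (by simpa using hBu) (by simpa [Matrix.add_mul] using hB₂u)
    simpa [Matrix.add_mul] using this
  have e4 : (1 - (W + D)) - (1 - W) = -D := by abel
  rw [e1, e2, e3, e4]
  -- term 2 carries the linear part `D`: `P⁻¹ D B₂⁻¹ P₂ − D = P⁻¹ (D (B₂⁻¹ − 1) P₂ + (D P₂ − P D))`
  have hPP : (1 - W)⁻¹ * (1 - W) = 1 := Matrix.nonsing_inv_mul _ hPu
  have t2 : (1 - W)⁻¹ * D * (1 + (W + D) * X)⁻¹ * (1 - (W + D)) - D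
      = (1 - W)⁻¹ * (D * ((1 + (W + D) * X)⁻¹ - 1) * (1 - (W + D)) + (W * D - D * (W + D))) := by
    have h : (1 - W)⁻¹ * (D * ((1 + (W + D) * X)⁻¹ - 1) * (1 - (W + D)) + (W * D - D * (W + D)))
        = (1 - W)⁻¹ * D * (1 + (W + D) * X)⁻¹ * (1 - (W + D)) - ((1 - W)⁻¹ * (1 - W)) * D := by noncomm_ring
    rw [h, hPP, Matrix.one_mul]
  -- regroup: total = term1 + (term2 − D) + term3 + term4
  have regroup : ∀ (T1 T2 T3 T4 : Matrix m m F), T1 + T2 + T3 + T4 - D = T1 + (T2 - D) + T3 + T4 := fun _ _ _ _ => by abel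
  rw [regroup, t2]
  -- bounds
  have b1 : ValBound (ρ * δ) ((1 - (W + D))⁻¹ * D * (1 - W)⁻¹ * (W + D + X) * (1 + (W + D) * X)⁻¹ * (1 - (W + D))) := by
    have := ((((hP₂inv.mul hD).mul hPinv).mul hA₂).mul hB₂inv).mul hP₂1
    refine (by simpa using this : ValBound (δ * ρ) _).mono (by rw [mul_comm])
  have b2 : ValBound (ρ * δ) ((1 - W)⁻¹ * (D * ((1 + (W + D) * X)⁻¹ - 1) * (1 - (W + D)) + (W * D - D * (W + D)))) := by
    have h21 : ValBound (ρ * δ) (D * ((1 + (W + D) * X)⁻¹ - 1) * (1 - (W + D))) := by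
      have := (hD.mul hE₂).mul hP₂1
      refine (by simpa using this : ValBound (δ * (ρ * ρ)) _).mono ?_
      calc δ * (ρ * ρ) = ρ * δ * ρ := by rw [mul_comm δ, mul_assoc, mul_comm ρ δ, ← mul_assoc, mul_comm δ ρ]
        _ ≤ ρ * δ * 1 := mul_le_mul' le_rfl hρ1
        _ = ρ * δ := mul_one _
    have h22 : ValBound (ρ * δ) (W * D - D * (W + D)) :=
      (hW.mul hD).sub (by simpa [mul_comm] using hD.mul hW₂)
    simpa using hPinv.mul (h21.add h22)
  have b3 : ValBound (ρ * δ) ((1 - W)⁻¹ * (W + X) * -((1 + (W + D) * X)⁻¹ * (D * X) * (1 + W * X)⁻¹) * (1 - (W + D))) := by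
    have hin : ValBound (δ * ρ) ((1 + (W + D) * X)⁻¹ * (D * X) * (1 + W * X)⁻¹) := by
      simpa using (hB₂inv.mul (hD.mul hX)).mul hBinv
    have := ((hPinv.mul hA).mul hin.neg).mul hP₂1
    refine (by simpa using this : ValBound (ρ * (δ * ρ)) _).mono ?_
    calc ρ * (δ * ρ) = ρ * δ * ρ := by rw [mul_assoc]
      _ ≤ ρ * δ * 1 := mul_le_mul' le_rfl hρ1
      _ = ρ * δ := mul_one _
  have b4 : ValBound (ρ * δ) ((1 - W)⁻¹ * (W + X) * (1 + W * X)⁻¹ * -D) := by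
    simpa using ((hPinv.mul hA).mul hBinv).mul hD.neg
  exact ((b1.add b2).add b3).add b4

end Valued

/-! ## §2 Conjugating the Cayley transform -/

section Conj

variable {R : Type*} [CommRing R] {n : Type*} [Fintype n] [DecidableEq n]

/-- `T⁻¹ (1 ± X) T = 1 ± T⁻¹ X T` and **`T⁻¹ c(X) T = c(T⁻¹ X T)`** for `T Tinv = Tinv T = 1` and `det(1 − X)` a unit. [cite: PlatonovRapinchuk1994, §3.3] -/
theorem conj_cayley {T Tinv X : Matrix n n R} (hT : T * Tinv = 1) (hT' : Tinv * T = 1) (hX : IsUnit (1 - X).det) :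
    Tinv * cayley X * T = cayley (Tinv * X * T) := by
  have hdet : (1 - Tinv * X * T).det = (1 - X).det := by
    have : 1 - Tinv * X * T = Tinv * (1 - X) * T := by
      rw [Matrix.mul_sub, Matrix.sub_mul, Matrix.mul_one, hT']
    rw [this, Matrix.det_mul, Matrix.det_mul, mul_comm (Tinv.det), mul_assoc, ← Matrix.det_mul, hT', Matrix.det_one, mul_one]
  have hX' : IsUnit (1 - Tinv * X * T).det := by rwa [hdet]
  -- characterise `c(X′)` by `c(X′) (1 − X′) = 1 + X′`
  have key : Tinv * cayley X * T * (1 - Tinv * X * T) = 1 + Tinv * X * T := by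
    have e : (1 - Tinv * X * T) = Tinv * (1 - X) * T := by rw [Matrix.mul_sub, Matrix.sub_mul, Matrix.mul_one, hT']
    rw [e]
    calc Tinv * cayley X * T * (Tinv * (1 - X) * T) = Tinv * (cayley X * ((T * Tinv) * (1 - X))) * T := by
          simp only [Matrix.mul_assoc]
      _ = Tinv * (1 + X) * T := by rw [hT, Matrix.one_mul, cayley_mul_one_sub hX]
      _ = 1 + Tinv * X * T := by rw [Matrix.mul_add, Matrix.add_mul, Matrix.mul_one, hT']
  calc Tinv * cayley X * T = Tinv * cayley X * T * ((1 - Tinv * X * T) * (1 - Tinv * X * T)⁻¹) := by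
        rw [Matrix.mul_nonsing_inv _ hX', Matrix.mul_one]
    _ = (1 + Tinv * X * T) * (1 - Tinv * X * T)⁻¹ := by rw [← Matrix.mul_assoc, key]
    _ = cayley (Tinv * X * T) := (cayley_def _).symm

end Conj

/-! ## §3 The tube in the chart -/

section Tube

variable {F : Type*} [Field F] [ValuativeRel F] {m : Type*} [Fintype m] [DecidableEq m]

omit [DecidableEq m] in
/-- Conjugation by an integral unit preserves entrywise bounds: `T, T⁻¹ ≤ 1`, `X ≤ ρ` ⇒ `T⁻¹ X T ≤ ρ`. [cite: PlatonovRapinchuk1994, §3.3] -/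
theorem valBound_conj {ρ : ValueGroupWithZero F} {T Tinv X : Matrix m m F} (hT1 : ValBound 1 T) (hTinv1 : ValBound 1 Tinv)
    (hX : ValBound ρ X) : ValBound ρ (Tinv * X * T) := by
  simpa using (hTinv1.mul hX).mul hT1

/-- **THE TUBE IN THE CHART**: `T⁻¹·c(X)·T·c(Y)·c(−X) = c(Θ)`, `Θ = S(T⁻¹XT, S(Y, −X))`, for `X, Y ≤ ρ < 1` and `T, T⁻¹` integral.
[cite: Serre1992LALG, Part II Ch. IV §8] [cite: PlatonovRapinchuk1994, §3.3] -/
theorem cayley_twisted_triple {ρ : ValueGroupWithZero F} {T Tinv X Y : Matrix m m F} (hT : T * Tinv = 1) (hT' : Tinv * T = 1)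
    (hT1 : ValBound 1 T) (hTinv1 : ValBound 1 Tinv) (hX : ValBound ρ X) (hY : ValBound ρ Y) (hρ : ρ < 1) :
    Tinv * cayley X * T * cayley Y * cayley (-X)
      = cayley ((1 - Tinv * X * T)⁻¹ * (Tinv * X * T + ((1 - Y)⁻¹ * (Y + -X) * (1 + Y * -X)⁻¹ * (1 - Y)))
          * (1 + (Tinv * X * T) * ((1 - Y)⁻¹ * (Y + -X) * (1 + Y * -X)⁻¹ * (1 - Y)))⁻¹ * (1 - Tinv * X * T)) := by
  have hX' := valBound_conj hT1 hTinv1 hX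
  have hnX : ValBound ρ (-X) := hX.neg
  obtain ⟨hXu, -, -⟩ := isUnit_det_one_sub_of_valBound hX hρ
  obtain ⟨hX'u, -, -⟩ := isUnit_det_one_sub_of_valBound hX' hρ
  obtain ⟨hYu, -, -⟩ := isUnit_det_one_sub_of_valBound hY hρ
  obtain ⟨hnXu, -, -⟩ := isUnit_det_one_sub_of_valBound hnX hρ
  obtain ⟨hBu, -, -⟩ := isUnit_det_one_add_mul_of_valBound hY hnX hρ hρ.le
  have hZ : ValBound ρ ((1 - Y)⁻¹ * (Y + -X) * (1 + Y * -X)⁻¹ * (1 - Y)) := by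
    simpa using valBound_cayleySandwich hY hnX hρ hρ
  obtain ⟨hZu, -, -⟩ := isUnit_det_one_sub_of_valBound hZ hρ
  obtain ⟨hB'u, -, -⟩ := isUnit_det_one_add_mul_of_valBound hX' hZ hρ hρ.le
  rw [conj_cayley hT hT' hXu, Matrix.mul_assoc, cayley_mul_cayley_eq_cayley hYu hnXu hBu,
    cayley_mul_cayley_eq_cayley hX'u hZu hB'u]

omit [ValuativeRel F] in
/-- The tube map vanishes at the origin: `Θ(0, 0) = 0`. [cite: Serre1992LALG, Part II Ch. IV §8] -/
theorem twistedSandwich_zero (T Tinv : Matrix m m F) :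
    (1 - Tinv * (0 : Matrix m m F) * T)⁻¹ * (Tinv * 0 * T + ((1 - (0 : Matrix m m F))⁻¹ * (0 + -0) * (1 + 0 * -(0 : Matrix m m F))⁻¹ * (1 - 0)))
      * (1 + (Tinv * 0 * T) * ((1 - (0 : Matrix m m F))⁻¹ * (0 + -0) * (1 + 0 * -(0 : Matrix m m F))⁻¹ * (1 - 0)))⁻¹ * (1 - Tinv * 0 * T) = 0 := by
  simp

/-- The tube map stays in the box: `Θ(X, Y) ≤ ρ`. [cite: Serre1992LALG, Part II Ch. IV §8] -/
theorem valBound_twistedSandwich {ρ : ValueGroupWithZero F} {T Tinv X Y : Matrix m m F}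
    (hT1 : ValBound 1 T) (hTinv1 : ValBound 1 Tinv) (hX : ValBound ρ X) (hY : ValBound ρ Y) (hρ : ρ < 1) :
    ValBound ρ ((1 - Tinv * X * T)⁻¹ * (Tinv * X * T + ((1 - Y)⁻¹ * (Y + -X) * (1 + Y * -X)⁻¹ * (1 - Y)))
          * (1 + (Tinv * X * T) * ((1 - Y)⁻¹ * (Y + -X) * (1 + Y * -X)⁻¹ * (1 - Y)))⁻¹ * (1 - Tinv * X * T)) := by
  have hX' := valBound_conj hT1 hTinv1 hX
  have hZ : ValBound ρ ((1 - Y)⁻¹ * (Y + -X) * (1 + Y * -X)⁻¹ * (1 - Y)) := by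
    simpa using valBound_cayleySandwich hY hX.neg hρ hρ
  simpa using valBound_cayleySandwich hX' hZ hρ hρ

/-! ## §4 The filtered Newton estimate for the tube map -/

/-- **JOINT INCREMENT OF THE SANDWICH**: `S(W + D, X + E) − S(W, X) − D − E ≤ ρ·max δ ε` for `W, X ≤ ρ < 1`, `D ≤ δ ≤ ρ`, `E ≤ ε ≤ ρ`
(first-argument increment §1 + second-argument increment ★ (C2)). [cite: Serre1992LALG, Part II Ch. IV §8] -/
theorem valBound_cayleySandwich_incr_both {ρ δ ε : ValueGroupWithZero F} {W X D E : Matrix m m F} (hW : ValBound ρ W) (hX : ValBound ρ X)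
    (hD : ValBound δ D) (hE : ValBound ε E) (hρ : ρ < 1) (hδ : δ ≤ ρ) (hε : ε ≤ ρ) :
    ValBound (ρ * max δ ε) (((1 - (W + D))⁻¹ * ((W + D) + (X + E)) * (1 + (W + D) * (X + E))⁻¹ * (1 - (W + D)))
      - ((1 - W)⁻¹ * (W + X) * (1 + W * X)⁻¹ * (1 - W)) - D - E) := by
  have hXE : ValBound ρ (X + E) := hX.add (hE.mono hε)
  -- split: [S(W+D, X+E) − S(W, X+E) − D] + [S(W, X+E) − S(W, X) − E]
  have h1 := valBound_cayleySandwich_incr_left (X := X + E) hW hXE hD hρ hδ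
  have h2 := valBound_cayleySandwich_incr hW hX hE hρ hρ hε
  have e : ((1 - (W + D))⁻¹ * ((W + D) + (X + E)) * (1 + (W + D) * (X + E))⁻¹ * (1 - (W + D)))
      - ((1 - W)⁻¹ * (W + X) * (1 + W * X)⁻¹ * (1 - W)) - D - E
      = (((1 - (W + D))⁻¹ * ((W + D) + (X + E)) * (1 + (W + D) * (X + E))⁻¹ * (1 - (W + D)))
          - ((1 - W)⁻¹ * (W + (X + E)) * (1 + W * (X + E))⁻¹ * (1 - W)) - D)
        + (((1 - W)⁻¹ * (W + (X + E)) * (1 + W * (X + E))⁻¹ * (1 - W))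
          - ((1 - W)⁻¹ * (W + X) * (1 + W * X)⁻¹ * (1 - W)) - E) := by abel
  rw [e]
  exact (h1.mono (mul_le_mul' le_rfl (le_max_left _ _))).add (h2.mono (mul_le_mul' le_rfl (le_max_right _ _)))

omit [DecidableEq m] in
/-- **THE FILTERED NEWTON ESTIMATE FOR A TWISTED COMPOSITE, abstract form**: for ANY binary operation `S` on matrices which stays in the box and whose
joint increments gain the factor `ρ` (★ (C2) + §1 for the Cayley sandwich), the tube map `Θ(X, Y) := S(T⁻¹XT, S(Y, −X))` satisfies
`Θ(X + X₁, Y + Y₁) − Θ(X, Y) − (T⁻¹X₁T − X₁ + Y₁) ≤ ργ` for `T, T⁻¹` integral, `X, Y ≤ ρ < 1`, `X₁, Y₁ ≤ γ ≤ ρ`. [cite: Serre1992LALG, Part II Ch. IV §8] -/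
theorem valBound_twisted_incr_of_sandwich (S : Matrix m m F → Matrix m m F → Matrix m m F) {ρ γ : ValueGroupWithZero F} (hρ : ρ < 1) (hγ : γ ≤ ρ)
    (hbox : ∀ {W X : Matrix m m F}, ValBound ρ W → ValBound ρ X → ValBound ρ (S W X))
    (hincr : ∀ {δ ε : ValueGroupWithZero F} {W X D E : Matrix m m F}, ValBound ρ W → ValBound ρ X → ValBound δ D → ValBound ε E →
      δ ≤ ρ → ε ≤ ρ → ValBound (ρ * max δ ε) (S (W + D) (X + E) - S W X - D - E))
    {T Tinv X Y X₁ Y₁ : Matrix m m F} (hT1 : ValBound 1 T) (hTinv1 : ValBound 1 Tinv)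
    (hX : ValBound ρ X) (hY : ValBound ρ Y) (hX₁ : ValBound γ X₁) (hY₁ : ValBound γ Y₁) :
    ValBound (ρ * γ) (S (Tinv * (X + X₁) * T) (S (Y + Y₁) (-(X + X₁))) - S (Tinv * X * T) (S Y (-X)) - (Tinv * X₁ * T - X₁ + Y₁)) := by
  have hW : ValBound ρ (Tinv * X * T) := valBound_conj hT1 hTinv1 hX
  have hD : ValBound γ (Tinv * X₁ * T) := valBound_conj hT1 hTinv1 hX₁
  have hnX : ValBound ρ (-X) := hX.neg
  have hnX₁ : ValBound γ (-X₁) := hX₁.neg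
  -- inner increment: `E := S (Y + Y₁) (−X − X₁) − S Y (−X)` is `Y₁ − X₁` up to `ργ`, hence `≤ γ`
  have hinner : ValBound (ρ * γ) (S (Y + Y₁) (-X + -X₁) - S Y (-X) - Y₁ - -X₁) := by
    simpa only [max_self] using hincr hY hnX hY₁ hnX₁ hγ hγ
  have hZ : ValBound ρ (S Y (-X)) := hbox hY hnX
  have hE : ValBound γ (S (Y + Y₁) (-X + -X₁) - S Y (-X)) := by
    have e : S (Y + Y₁) (-X + -X₁) - S Y (-X) = (S (Y + Y₁) (-X + -X₁) - S Y (-X) - Y₁ - -X₁) + (Y₁ + -X₁) := by abel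
    rw [e]
    refine (hinner.mono ?_).add (hY₁.add hnX₁)
    calc ρ * γ ≤ 1 * γ := mul_le_mul' hρ.le le_rfl
      _ = γ := one_mul γ
  -- outer increment
  have houter : ValBound (ρ * γ) (S (Tinv * X * T + Tinv * X₁ * T) (S Y (-X) + (S (Y + Y₁) (-X + -X₁) - S Y (-X)))
      - S (Tinv * X * T) (S Y (-X)) - Tinv * X₁ * T - (S (Y + Y₁) (-X + -X₁) - S Y (-X))) := by
    simpa only [max_self] using hincr hW hZ hD hE hγ hγ
  -- assemble
  have eW : Tinv * (X + X₁) * T = Tinv * X * T + Tinv * X₁ * T := by rw [Matrix.mul_add, Matrix.add_mul]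
  have eZ : S Y (-X) + (S (Y + Y₁) (-X + -X₁) - S Y (-X)) = S (Y + Y₁) (-X + -X₁) := by abel
  have eN : -(X + X₁) = -X + -X₁ := neg_add X X₁
  rw [eW, eN, ← eZ]
  have e : S (Tinv * X * T + Tinv * X₁ * T) (S Y (-X) + (S (Y + Y₁) (-X + -X₁) - S Y (-X))) - S (Tinv * X * T) (S Y (-X))
        - (Tinv * X₁ * T - X₁ + Y₁)
      = (S (Tinv * X * T + Tinv * X₁ * T) (S Y (-X) + (S (Y + Y₁) (-X + -X₁) - S Y (-X)))
          - S (Tinv * X * T) (S Y (-X)) - Tinv * X₁ * T - (S (Y + Y₁) (-X + -X₁) - S Y (-X)))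
        + (S (Y + Y₁) (-X + -X₁) - S Y (-X) - Y₁ - -X₁) := by abel
  rw [e]
  exact houter.add hinner

/-- **THE FILTERED NEWTON ESTIMATE FOR THE TUBE MAP** (Cayley sandwich instance of the abstract form): with
`Θ(X, Y) = S(T⁻¹XT, S(Y, −X))`, `S(W, X) = (1 − W)⁻¹(W + X)(1 + WX)⁻¹(1 − W)`, and `L(X₁, Y₁) = T⁻¹X₁T − X₁ + Y₁`:
`Θ(X + X₁, Y + Y₁) − Θ(X, Y) − L(X₁, Y₁) ≤ ργ` for `T, T⁻¹` integral, `X, Y ≤ ρ < 1`, `X₁, Y₁ ≤ γ ≤ ρ`. [cite: Serre1992LALG, Part II Ch. IV §8] -/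
theorem valBound_twistedSandwich_incr {ρ γ : ValueGroupWithZero F} (hρ : ρ < 1) (hγ : γ ≤ ρ) {T Tinv X Y X₁ Y₁ : Matrix m m F}
    (hT1 : ValBound 1 T) (hTinv1 : ValBound 1 Tinv) (hX : ValBound ρ X) (hY : ValBound ρ Y) (hX₁ : ValBound γ X₁) (hY₁ : ValBound γ Y₁) :
    ValBound (ρ * γ)
      ((fun W Z : Matrix m m F => (1 - W)⁻¹ * (W + Z) * (1 + W * Z)⁻¹ * (1 - W)) (Tinv * (X + X₁) * T)
          ((fun W Z : Matrix m m F => (1 - W)⁻¹ * (W + Z) * (1 + W * Z)⁻¹ * (1 - W)) (Y + Y₁) (-(X + X₁)))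
        - (fun W Z : Matrix m m F => (1 - W)⁻¹ * (W + Z) * (1 + W * Z)⁻¹ * (1 - W)) (Tinv * X * T)
          ((fun W Z : Matrix m m F => (1 - W)⁻¹ * (W + Z) * (1 + W * Z)⁻¹ * (1 - W)) Y (-X))
        - (Tinv * X₁ * T - X₁ + Y₁)) :=
  valBound_twisted_incr_of_sandwich (fun W Z : Matrix m m F => (1 - W)⁻¹ * (W + Z) * (1 + W * Z)⁻¹ * (1 - W)) hρ hγ
    (fun hW hX => by simpa only [max_self] using valBound_cayleySandwich hW hX hρ hρ)
    (fun hW hX hD hE hδ hε => valBound_cayleySandwich_incr_both hW hX hD hE hρ hδ hε) hT1 hTinv1 hX hY hX₁ hY₁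

end Tube

end Literature.NumberTheory.Weil1982.UnitaryFinTopForm
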